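import Literature.NumberTheory.GelbartRogawski1991.RationalSymplecticUnramifiedVector
import Literature.NumberTheory.GelbartRogawski1991.LocalDoubledUnitaryDatum
import Literature.NumberTheory.Automorphic.QuadraticAdeleBaseChange
import HarnessLib

-- buildfix G11b-3 recipe (LEDGER B13-1/B13-3): elaborate sequentially so the trailing `attribute [implicit_reducible]`
-- block (reducibilityCoreExt is keyed to the async environment branch) is in force at `.olean` export.
set_option Elab.async false

/-!
# The good places of the doubled unitary datum: the standing hypotheses of the unramified clause, and their
# cofiniteness ([GelbartRogawski1991, §3.1 (3.1.3)]; [MoeglinVignerasWaldspurger1987, Chap. 2 II.10])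

Topic `NumberTheory/GelbartRogawski1991`; namespace
`Literature.NumberTheory.GelbartRogawski1991.UnitaryDualPair.LocalSplitting`.  KERNEL only: one structure (a `Prop`) and
proved lemmas; no named fact, no `sorry`.

`IsGoodPlace F E δ v n T₀ χv` collects, at a finite place `v` of `F` and uniformly in the places `w ∣ v` of `E`, the
finitely many "almost all `v`" conditions under which the unramified clause of the [GelbartRogawski1991, Prop. 3.1.1]
construction holds for the doubled hermitian space `(E^n ⊕ E^n, T₀ ⊕ −T₀)` and a family of local characters
`χ_w : E_wˣ → ℂˣ`: `|2|_w = 1`, `|δ|_w = 1`, `T₀` integral at `w` with unit determinant, `χ_w` unramified, `ψ_v` of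
conductor `𝒪_v`, `½ ∈ 𝒪_v`, and `T₀ ⊕ −T₀` together with its inverse integral over `𝒪_v` (the last three in the
`F_v`-spelling consumed by `HeisenbergGroup/LeraySectionUnramifiedParabolic`).
**`eventually_isGoodPlace`**: all of them hold for all but finitely many `v`, except the unramifiedness of `χ`, which is
taken as a hypothesis `∀ᶠ v, ∀ w ∣ v, χ_w` unramified (a property of the Hecke character supplying `χ`).
Stage-1 cell `pub-hodgecm`, seat GR-1, input of bricks L7∕L7s of the local skeleton (2026-08-21).
-/

set_option autoImplicit false

noncomputable section

open NumberField IsDedekindDomain Matrix Filter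
open scoped ValuativeRel
open Literature.NumberTheory.Automorphic Literature.NumberTheory.Automorphic.UnitaryGroup
open Literature.NumberTheory.GaloisRepresentations.IsNonarchimedeanLocalField

namespace Literature.NumberTheory.GelbartRogawski1991.UnitaryDualPair.LocalSplitting

variable (F : Type) [Field F] [NumberField F] (E : Type) [Field E] [NumberField E] [Algebra F E]
  (δ : E) (v : HeightOneSpectrum (𝓞 F)) (n : ℕ) (T₀ : Matrix (Fin n) (Fin n) F)

/-- **the standing hypotheses of the unramified clause at a place `v`** (stated at every `w ∣ v`; each holds for all but
finitely many `v`). [cite: GelbartRogawski1991, §3.1 (3.1.3); MoeglinVignerasWaldspurger1987, Chap. 2 II.10] -/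
structure IsGoodPlace (χv : ∀ w : PlacesOver E v, (w.1.adicCompletion E)ˣ →* ℂˣ) : Prop where
  /-- `v ∤ 2`, read at every `w ∣ v` -/
  two : ∀ w : PlacesOver E v, ValuativeRel.valuation (w.1.adicCompletion E) (2 : w.1.adicCompletion E) = 1
  /-- `δ` is a unit at every `w ∣ v` -/
  delta : ∀ w : PlacesOver E v, ValuativeRel.valuation (w.1.adicCompletion E) (algebraMap E (w.1.adicCompletion E) δ) = 1
  /-- `T₀` is integral at every `w ∣ v` … -/
  gram : ∀ (w : PlacesOver E v) (i j : Fin n),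
    ValuativeRel.valuation (w.1.adicCompletion E) (algebraMap E (w.1.adicCompletion E) (algebraMap F E (T₀ i j))) ≤ 1
  /-- … with unit determinant -/
  gramDet : ∀ w : PlacesOver E v,
    ValuativeRel.valuation (w.1.adicCompletion E) (algebraMap E (w.1.adicCompletion E) (algebraMap F E T₀.det)) = 1
  /-- every `χ_w` is unramified -/
  chi : ∀ (w : PlacesOver E v) (u : (w.1.adicCompletion E)ˣ),
    ValuativeRel.valuation (w.1.adicCompletion E) (u : w.1.adicCompletion E) = 1 → χv w u = 1
  /-- `ψ_v` has conductor `𝒪_v` -/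
  psi : (adeleAddCharAt F v).HasConductorExp 0
  /-- `½ ∈ 𝒪_v` -/
  twoF : (⅟(2 : v.adicCompletion F)) ∈ primePowBall (v.adicCompletion F) 0
  /-- `T₀ ⊕ (−T₀)` is integral at `v` … -/
  gramF : ∀ i j, localGram F (n + n) (gramD F n T₀) v i j ∈ primePowBall (v.adicCompletion F) 0
  /-- … with integral inverse -/
  gramFinv : ∀ i j, (localGram F (n + n) (gramD F n T₀) v)⁻¹ i j ∈ primePowBall (v.adicCompletion F) 0

/-! ## Cofiniteness -/

omit [NumberField F] in
/-- the two valuations of `E_w` agree on "`= 1`". [cite: CasselsFrohlichANT1967, Ch. II §10] -/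
theorem valuation_eq_one_iff_valued (w : HeightOneSpectrum (𝓞 E)) (x : w.adicCompletion E) :
    ValuativeRel.valuation (w.adicCompletion E) x = 1 ↔ Valued.v x = 1 :=
  (ValuativeRel.isEquiv (ValuativeRel.valuation (w.adicCompletion E))
    (Valued.v : Valuation (w.adicCompletion E) _)).eq_one_iff_eq_one

omit [NumberField F] in
/-- a non-zero element of `E` is a `w`-unit for almost all `w`. [cite: CasselsFrohlichANT1967, Ch. II §14] -/
theorem eventually_valuation_algebraMap_eq_one {e : E} (he : e ≠ 0) :
    ∀ᶠ w : HeightOneSpectrum (𝓞 E) in cofinite,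
      ValuativeRel.valuation (w.adicCompletion E) (algebraMap E (w.adicCompletion E) e) = 1 :=
  (UnitaryGroup.eventually_valued_algebraMap_eq_one (E := E) he).mono fun w hw =>
    (valuation_eq_one_iff_valued E w _).2 hw

omit [NumberField F] in
/-- an element of `E` is `w`-integral for almost all `w`. [cite: CasselsFrohlichANT1967, Ch. II §14] -/
theorem eventually_valuation_algebraMap_le_one (e : E) :
    ∀ᶠ w : HeightOneSpectrum (𝓞 E) in cofinite,
      ValuativeRel.valuation (w.adicCompletion E) (algebraMap E (w.adicCompletion E) e) ≤ 1 := by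
  by_cases he : e = 0
  · exact Eventually.of_forall fun w => by rw [he, map_zero, map_zero]; exact zero_le_one
  · exact (eventually_valuation_algebraMap_eq_one E he).mono fun w hw => hw.le

/-- inverses of invertible matrices commute with ring maps. [cite: CasselsFrohlichANT1967, Ch. II §14] -/
private theorem map_nonsing_inv_of_isUnit' {R R' : Type*} [CommRing R] [CommRing R'] {m : Type*} [Fintype m] [DecidableEq m]
    (f : R →+* R') {M : Matrix m m R} (hM : IsUnit M.det) : (M⁻¹).map f = (M.map f)⁻¹ := by
  refine (Matrix.inv_eq_left_inv ?_).symm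
  rw [← Matrix.map_mul, Matrix.nonsing_inv_mul M hM, Matrix.map_one f (map_zero f) (map_one f)]

/-- **the good places are cofinite**: given a family of local characters that is unramified at almost every place, every
condition of `IsGoodPlace` holds for all but finitely many `v` (`δ ≠ 0`, `T₀ ∈ GL_n(F)`).
[cite: GelbartRogawski1991, §3.1 (3.1.3); CasselsFrohlichANT1967, Ch. II §14] -/
theorem eventually_isGoodPlace (hδ : δ ≠ 0) (hT₀d : IsUnit T₀.det)
    (χ : ∀ (v : HeightOneSpectrum (𝓞 F)) (w : PlacesOver E v), (w.1.adicCompletion E)ˣ →* ℂˣ)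
    (hχ : ∀ᶠ v : HeightOneSpectrum (𝓞 F) in cofinite, ∀ (w : PlacesOver E v) (u : (w.1.adicCompletion E)ˣ),
      ValuativeRel.valuation (w.1.adicCompletion E) (u : w.1.adicCompletion E) = 1 → χ v w u = 1) :
    ∀ᶠ v : HeightOneSpectrum (𝓞 F) in cofinite, IsGoodPlace F E δ v n T₀ (χ v) := by
  -- the `E`-side conditions, place by place of `E`, pushed down to `v`
  have h2E : ∀ᶠ w : HeightOneSpectrum (𝓞 E) in cofinite,
      ValuativeRel.valuation (w.adicCompletion E) (2 : w.adicCompletion E) = 1 :=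
    (eventually_valuation_algebraMap_eq_one E (two_ne_zero : (2 : E) ≠ 0)).mono fun w hw => by rwa [map_ofNat] at hw
  have hδE := eventually_valuation_algebraMap_eq_one E hδ
  have hdetE : ∀ᶠ w : HeightOneSpectrum (𝓞 E) in cofinite,
      ValuativeRel.valuation (w.adicCompletion E) (algebraMap E (w.adicCompletion E) (algebraMap F E T₀.det)) = 1 :=
    eventually_valuation_algebraMap_eq_one E (by
      rw [Ne, map_eq_zero_iff _ (algebraMap F E).injective]; exact hT₀d.ne_zero)
  have hgramE : ∀ᶠ w : HeightOneSpectrum (𝓞 E) in cofinite, ∀ i j : Fin n,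
      ValuativeRel.valuation (w.adicCompletion E) (algebraMap E (w.adicCompletion E) (algebraMap F E (T₀ i j))) ≤ 1 := by
    simp only [eventually_all]
    exact fun i j => eventually_valuation_algebraMap_le_one E _
  have hE := eventually_forall_placesOver (F := F) E ((h2E.and hδE).and (hdetE.and hgramE))
  -- the `F`-side conditions
  have hinv : IsUnit (gramD F n T₀).det := isUnit_det_gramD F n hT₀d
  have hF := ((eventually_forall_entry_mem F (gramD F n T₀)).and (eventually_forall_entry_mem F (gramD F n T₀)⁻¹)).and
    ((eventually_invOf_two_mem F).and (eventually_hasConductorExp_zero_adicComponent_adeleAddChar (K := F)))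
  filter_upwards [hE, hF, hχ] with v hEv hFv hχv
  obtain ⟨⟨hgF, hgFi⟩, h2F, hψ⟩ := hFv
  refine ⟨fun w => (hEv w).1.1, fun w => (hEv w).1.2, fun w i j => (hEv w).2.2 i j, fun w => (hEv w).2.1, hχv, hψ,
    (mem_primePowBall_zero_iff _).2 h2F, fun i j => (mem_primePowBall_zero_iff _).2 (hgF i j), fun i j => ?_⟩
  rw [localGram, ← map_nonsing_inv_of_isUnit' _ hinv, Matrix.map_apply]
  exact (mem_primePowBall_zero_iff _).2 (hgFi i j)

/-! ### Build-lane note (ops-buildfix G11b-3 recipe, LEDGER B13-1, 2026-08-21)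
`lean -o` (the hub build lane, never `lean`/the gate check) runs Lean 4.32's library-suggestion indexers
(`Lean.LibrarySuggestions.SymbolFrequency` / `SineQuaNon`, from their `exportEntriesFn`) over the statement of
every local theorem that is not a denied premise; on this family's statements (very large dependent binder
telescopes through the theta-kernel / dual-pair data) that fold runs for tens of minutes to hours and the build
lane kills the job (incident G11b-3, run/shared/lean/ops/buildfix/G11b-3-DOSSIER.md). `isDeniedPremise` skips
`[implicit_reducible]` constants before any fold, and a reducibility status on a *theorem* is inert (Meta never
unfolds `thmInfo`; the kernel ignores the attribute), so the public theorems of this file are tagged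
`[implicit_reducible]` purely to keep them out of that index. Only other effect: they are not offered by
`+suggestions` premise selectors. No statement or proof is changed; superseded if the operator lands a
deny-list form (`HarnessLib.PremiseIndex`). -/
set_option allowUnsafeReducibility true in
attribute [implicit_reducible]
  valuation_eq_one_iff_valued eventually_valuation_algebraMap_eq_one
  eventually_valuation_algebraMap_le_one eventually_isGoodPlace

end Literature.NumberTheory.GelbartRogawski1991.UnitaryDualPair.LocalSplitting

end
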